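import Literature.NumberTheory.EllipticCurves.DeligneSerreLiftModL
import Literature.NumberTheory.EllipticCurves.DeligneSerreWeightOneBound
import Literature.NumberTheory.GaloisRepresentations.ResidualRepresentation
import Literature.RepresentationTheory.Semisimple.FinTwoSemisimplification
import Literature.RingTheory.DiscreteValuationRing.AdicCompletionResidueField
import Literature.NumberTheory.LFunctions.DirichletDensityLemmas
import HarnessLib

/-!
# Deligne–Serre 1974, Thm. 6.7 in weight one, from Thm. 6.1 (Deligne) and Lemme 6.13

This file PROVES the named fact `thm67_weightOne` (`NewformGaloisRepModL`: the mod-`ℓ`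
representations attached to a weight-one newform `f ∈ S_1(Γ₁(N))` and `ι : 𝓞_f → 𝔽_ℓ`) from the
two printed inputs of its proof which the tree does not prove, taken as **hypotheses stated
exactly as printed** (this provefact unit may not introduce named facts, D-0026; the statements
`H61` and `H613` below are the ones to be vendored as `DeligneSerre1974.thm61`,
`DeligneSerre1974.lemma613` by the split path):

* **Thm. 6.1** (Deligne; op. cit. p. 520): for `f ∈ S_k(Γ₁(M))` of type `(k, χ)`, `k ≥ 2`,
  `f ≠ 0`, an eigenvector of the `T_p`, `p ∤ M`, with eigenvalues `a_p`, a number field `K`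
  (embedded in `ℂ` by `e`) containing the `a_p` and the `χ(p)`, and **every** finite place `v` of
  `K`, there is a continuous semisimple `ρ : Gal(ℚ̄/ℚ) → GL₂(K_v)` unramified outside `M ℓ`
  (`ℓ` the residue characteristic of `v`) with `det(X - ρ(F_p)) = X² - a_p X + χ(p) p^{k-1}`
  (6.1.1). (The tree's `exists_padicGaloisRep_of_isNewform1` / `Ribet1977.thm21_exists_galoisRep`
  give this for newforms and *one* unspecified place above each `ℓ` only, which does not suffice:
  Thm. 6.7 is about every `λ`.)
* **Lemme 6.13** (op. cit. p. 523), `n = 2`: a semisimple `φ : Φ → GL₂(k')`, `k'` finite, all of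
  whose characteristic polynomials have coefficients in the subfield `k`, is realisable over
  `k`.

together with the two named facts already used by the weight-one assembly
(`DeligneSerreWeightOneAssembly`): Chebotarev (`LFunctions.Chebotarev.dirichletDensity_eq`) and
(2.7.2) (`DeligneSerre1974_span_integralLattice1 N 1`). All the glue of the printed proof
(6.8–6.12) is proved in the tree: `EisensteinCongruence` (6.9), `DeligneSerreEigenvectorLift`
and `DeligneSerreLiftModL` (6.10–6.11), `StableLattice`, `ResidualRepresentation`,
`FinTwoSemisimplification`, `DvrPlace` (6.12), and the Frobenius-coverage lemma
`exists_isArithFrobAt_apply_eq` below ((6.12.1): "d'après le théorème de Čebotarev, tout élément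
de `φ̃(G)` est de la forme `F_{𝔓,p}` avec `p ∤ N ℓ`").

* `Literature.NumberTheory.EllipticCurves.ModularForms.DeligneSerre1974.thm67_weightOne_of_descent` —
  the same with Lemme 6.13 weakened to the descent statement actually used (implied by 6.13 and
  proved in `Literature/RepresentationTheory/Semisimple/FiniteFieldDescentAbsIrred`);
* `Literature.NumberTheory.EllipticCurves.ModularForms.DeligneSerre1974.thm67_weightOne_of_thm61`.

## References

* P. Deligne, J.-P. Serre, *Formes modulaires de poids 1*, Ann. Sci. ÉNS (4) 7 (1974), Thm. 6.1,
  6.6–6.13, §8.2.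
-/

noncomputable section

open scoped MatrixGroups ModularForm NumberField Polynomial Pointwise

open CongruenceSubgroup UpperHalfPlane IsLocalRing IsDedekindDomain Polynomial
  Rat.HeightOneSpectrum Field

namespace Literature.NumberTheory.EllipticCurves.ModularForms.DeligneSerre1974

/-! ### (6.12.1): every element of a finite Galois image is a Frobenius, from Chebotarev -/

section Frobenius

/-- **Every element of the image of a continuous representation of `Gal(ℚ̄/ℚ)` with finite image
is a Frobenius at a prime outside any finite set** (Deligne–Serre 1974, 6.12: "d'après le
théorème de Čebotarev, tout élément de `φ̃(G)` est de la forme `F_{𝔓,p}`, avec `p ∤ N ℓ`"), from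
Chebotarev's density theorem in the Dirichlet-density form `dirichletDensity_eq` (the conjugacy
class of `φ(g)` in the finite image has positive density, hence is the Frobenius class of
infinitely many primes; a conjugate of a Frobenius is a Frobenius). [cite: DeligneSerreASENS1974, 6.12 (6.12.1)] -/
theorem exists_isArithFrobAt_apply_eq (hCheb : LFunctions.Chebotarev.dirichletDensity_eq.{0})
    {H : Type} [Group H] (φ : absoluteGaloisGroup ℚ →* H) (hker : IsOpen (φ.ker : Set (absoluteGaloisGroup ℚ)))
    (T : Set ℕ) (hT : T.Finite) (g : absoluteGaloisGroup ℚ) :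
    ∃ v : HeightOneSpectrum (𝓞 ℚ), ((primesEquiv v : Nat.Primes) : ℕ) ∉ T ∧
      ∃ 𝔓 ∈ v.primesAbove, ∃ σ : absoluteGaloisGroup ℚ, IsArithFrobAt (𝓞 ℚ) σ 𝔓 ∧ φ σ = φ g := by
  classical
  set G : Subgroup H := φ.range with hGdef
  set ψ : absoluteGaloisGroup ℚ →* G := φ.rangeRestrict with hψdef
  have hψsurj : Function.Surjective ψ := MonoidHom.rangeRestrict_surjective _
  have hψker : IsOpen ((ψ.ker : Subgroup (absoluteGaloisGroup ℚ)) : Set (absoluteGaloisGroup ℚ)) := by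
    have : (ψ.ker : Set (absoluteGaloisGroup ℚ)) = (φ.ker : Set (absoluteGaloisGroup ℚ)) := by
      ext σ
      simp only [SetLike.mem_coe, MonoidHom.mem_ker, hψdef]
      rw [← Subtype.coe_inj, MonoidHom.coe_rangeRestrict, OneMemClass.coe_one]
    rw [this]; exact hker
  haveI : Finite (absoluteGaloisGroup ℚ ⧸ ψ.ker) := Subgroup.quotient_finite_of_isOpen _ hψker
  haveI : Finite G := Finite.of_surjective _
    ((QuotientGroup.quotientKerEquivOfSurjective ψ hψsurj).surjective)
  -- the conjugacy class of `ψ g`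
  set C : Set G := {h | ∃ x : G, h = x * ψ g * x⁻¹} with hCdef
  have hCconj : ∀ x h : G, h ∈ C → x * h * x⁻¹ ∈ C := by
    rintro x h ⟨y, rfl⟩
    exact ⟨x * y, by group⟩
  have hCne : (ψ g) ∈ C := ⟨1, by group⟩
  have hdens := hCheb ψ hψker hψsurj C hCconj
  have hpos : (0 : ℝ) < (Nat.card C : ℝ) / Nat.card G := by
    haveI : Finite C := Finite.Set.subset (Set.univ) (Set.subset_univ _)
    have h1 : 0 < Nat.card C := Nat.card_pos_iff.mpr ⟨⟨⟨_, hCne⟩⟩, inferInstance⟩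
    have h2 : 0 < Nat.card G := Nat.card_pos
    positivity
  -- a prime `p ∉ T` in the Chebotarev set
  obtain ⟨B, hB⟩ : ∃ B : ℕ, ∀ t ∈ T, t ≤ B := ⟨hT.toFinset.sup id, fun t ht ↦
    Finset.le_sup (f := id) (hT.mem_toFinset.mpr ht)⟩
  obtain ⟨p, hp, hpC, hpB⟩ := LFunctions.PrimeSum.exists_gt_of_tendsto_pos hpos
    (LFunctions.hasDirichletDensity_iff.mp hdens) B
  have hpT : p ∉ T := fun h ↦ not_lt.mpr (hB p h) hpB
  obtain ⟨v, rfl, -, hfrob⟩ := hpC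
  obtain ⟨𝔓, h𝔓⟩ := HeightOneSpectrum.primesAbove_nonempty v
  obtain ⟨σ, hσ⟩ := HeightOneSpectrum.exists_isArithFrobAt_of_mem_primesAbove_holds h𝔓
  obtain ⟨x, hx⟩ := hfrob 𝔓 h𝔓 σ hσ
  obtain ⟨τ, rfl⟩ := hψsurj x
  -- conjugate back: `τ⁻¹ σ τ` is a Frobenius at `τ⁻¹ • 𝔓` with image `φ g`
  refine ⟨v, hpT, τ⁻¹ • 𝔓, smul_mem_primesAbove h𝔓 τ⁻¹, τ⁻¹ * σ * τ⁻¹⁻¹, hσ.conj τ⁻¹, ?_⟩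
  have hx' : φ σ = φ τ * φ g * (φ τ)⁻¹ := congrArg Subtype.val hx
  rw [map_mul, map_mul, inv_inv, map_inv, hx']
  group

end Frobenius

/-! ### Continuity of homomorphisms with open kernel into discrete groups -/

section Continuity

/-- A homomorphism from a topological group to a discrete group whose kernel contains an open
subgroup is continuous. [folklore] -/
theorem continuous_of_isOpen_of_le_ker {Γ H : Type*} [Group Γ] [TopologicalSpace Γ]
    [IsTopologicalGroup Γ] [Group H] [TopologicalSpace H] [DiscreteTopology H]
    (f : Γ →* H) (U : Subgroup Γ) (hU : IsOpen (U : Set Γ)) (hle : U ≤ f.ker) : Continuous f := by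
  have hker : IsOpen (f.ker : Set Γ) := Subgroup.isOpen_mono hle hU
  refine continuous_of_continuousAt_one f ?_
  rw [ContinuousAt, map_one]
  intro s hs
  have h1 : (1 : H) ∈ s := mem_of_mem_nhds hs
  rw [Filter.mem_map]
  exact Filter.mem_of_superset (hker.mem_nhds (one_mem _)) fun σ hσ ↦ by
    rw [Set.mem_preimage, show f σ = 1 from hσ]; exact h1

end Continuity

/-! ### Thm. 6.7 in weight one -/

section Main

variable {N : ℕ} [NeZero N]

/-- `GL_n(O) → GL_n(F)` is injective for a subring `O ⊆ F`. [folklore] -/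
theorem generalLinearGroup_map_injective_of_injective {R S : Type*} [CommRing R] [CommRing S]
    {n : Type*} [Fintype n] [DecidableEq n] (f : R →+* S) (hf : Function.Injective f) :
    Function.Injective (Matrix.GeneralLinearGroup.map (n := n) f) := by
  intro A B h
  refine Units.ext (Matrix.ext fun i j ↦ hf ?_)
  have := congrArg (fun M : GL n S ↦ (M : Matrix n n S) i j) h
  simpa [Matrix.GeneralLinearGroup.map] using this

set_option maxHeartbeats 1600000 in
/-- **Deligne–Serre 1974, 6.12–6.13 — the core of the proof of Thm. 6.7 in weight one.**  Fix the
weight-one newform `f`, the prime `ℓ` and `ι : 𝓞_f → 𝔽_ℓ`.  Suppose given a number field `K`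
with `i : K_f → K`, a finite place `v` of `K` over `λ = ker ι` (`v(i y) < 1` for `ι y = 0`), a
weight `k' ≥ 2` with `(ℓ - 1) ∣ (k' - 1)`, `v`-integral `b_p ∈ K` with `b_p ≡ a_p(f) (mod v)` and
`c_p = ε(p)` (in `K`, through `i`) for the primes `p ∤ N ℓ`, and a continuous
`ρ : Gal(ℚ̄/ℚ) → GL₂(K_v)` unramified at the primes `p ∤ N ℓ`, `p ∉ v`, with
`det(X - ρ(F_p)) = X² - b_p X + c_p p^{k'-1}` there (the output of Thm. 6.1 applied to a lift
of `f mod λ` as in 6.8–6.11).  Then the conclusion of Thm. 6.7 holds for `(f, ℓ, ι)`: there is a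
semisimple `ρ̄ : Gal(ℚ̄/ℚ) → GL₂(𝔽_ℓ)` attached to `f` through `ι` away from `N ℓ`.  Proof =
op. cit. 6.12 (integral model by compactness, `exists_integralModel`; reduction,
`isOpen_ker_residualRep`; semisimplification, `exists_semisimplification_fin_two`; (6.12.1) by
Chebotarev, `exists_isArithFrobAt_apply_eq`; `p^{k'-1} ≡ 1 (mod ℓ)`) and Lemme 6.13 in the
descent form `hdesc`, followed by a last semisimplification over `𝔽_ℓ`.  (Isolated from
`thm67_weightOne_of_descent` so that Thm. 6.1 may be supplied in other printed shapes — for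
newforms, over other coefficient fields — after enlarging `K`.)
[cite: DeligneSerreASENS1974, 6.12–6.13 (pp. 522–523)] -/
theorem thm67_weightOne_core
    (hdesc : ∀ (G : Type) [Group G] (k K : Type) [Field k] [Fintype k] [Field K] [Finite K]
      (j : k →+* K) (φ : G →* GL (Fin 2) K),
      Representation.IsSemisimpleRepresentation
        ((Representation.ofDistribMulAction K (GL (Fin 2) K) (Fin 2 → K)).comp φ) →
      (∀ x, ∃ Q : Polynomial k,
        Q.map j = ((φ x : GL (Fin 2) K) : Matrix (Fin 2) (Fin 2) K).charpoly) →
      ∃ ρ : G →* GL (Fin 2) k, φ.ker ≤ ρ.ker ∧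
        ∀ x, (((ρ x : GL (Fin 2) k) : Matrix (Fin 2) (Fin 2) k).charpoly).map j =
          ((φ x : GL (Fin 2) K) : Matrix (Fin 2) (Fin 2) K).charpoly)
    (hCheb : LFunctions.Chebotarev.dirichletDensity_eq.{0})
    (hL : DeligneSerre1974_span_integralLattice1 N 1)
    {f : CuspForm (Gamma1 N) 1} (hf : IsNewform1 f) (ℓ : ℕ) [Fact ℓ.Prime]
    (ι : coeffCharIntegers f →+* ZMod ℓ)
    {K : Type} [Field K] [NumberField K] (i : coeffCharField f →+* K)
    (v : HeightOneSpectrum (𝓞 K)) {k' : ℤ} (hk' : 2 ≤ k') (hℓk' : ((ℓ : ℤ) - 1 ∣ k' - 1))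
    (b c : ℕ → K)
    (hker : ∀ y : coeffCharIntegers f, ι y = 0 → v.valuation K (i y) < 1)
    (hbint : ∀ p : ℕ, v.valuation K (b p) ≤ 1)
    (hbcongr : ∀ p : ℕ, p.Prime → ¬ p ∣ N * ℓ →
      v.valuation K (b p - i ⟨cuspCoeff f p, cuspCoeff_mem_coeffCharField f p⟩) < 1)
    (hc : ∀ p : ℕ, p.Prime → ¬ p ∣ N * ℓ →
      c p = i ⟨(nebentypus f (p : ZMod N) : ℂ), nebentypus_mem_coeffCharField f p⟩)
    (ρ : GaloisRepresentations.FramedGaloisRep ℚ (v.adicCompletion K) 2)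
    (hρ : ∀ w : HeightOneSpectrum (𝓞 ℚ), ¬ ((primesEquiv w : Nat.Primes) : ℕ) ∣ N * ℓ →
      (((primesEquiv w : Nat.Primes) : ℕ) : 𝓞 K) ∉ v.asIdeal →
      ρ.IsUnramifiedAt w ∧
      ρ.HasFrobCharpolyAt w
        ((X ^ 2 - C (b ((primesEquiv w : Nat.Primes) : ℕ)) * X +
          C (c ((primesEquiv w : Nat.Primes) : ℕ) *
            (((primesEquiv w : Nat.Primes) : ℕ) : K) ^ (k' - 1))).map
          (algebraMap K (v.adicCompletion K)))) :
    ∃ ρbar : GaloisRepresentations.FramedGaloisRep ℚ (ZMod ℓ) 2,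
      IsGaloisRepOfNewform1Int f ι {p | p ∣ N * ℓ} ρbar ∧ ρbar.toGaloisRep.IsSemisimple := by
  classical
  have hℓ : ℓ.Prime := Fact.out
  haveI : NeZero (N * ℓ) := ⟨mul_ne_zero (NeZero.ne N) hℓ.ne_zero⟩
  set ε : DirichletCharacter ℂ N := nebentypus f with hεdef
  -- ### 6.12: integral model, reduction, semisimplification
  haveI : IsPrincipalIdealRing (v.adicCompletionIntegers K) := inferInstance
  have hOopen : IsOpen ((v.adicCompletionIntegers K) : Set (v.adicCompletion K)) := Valued.isOpen_valuationSubring _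
  obtain ⟨P, ρ₀, hρ₀⟩ := GaloisRepresentations.exists_integralModel (O := v.adicCompletionIntegers K) hOopen ρ
  have hmax : {x : (v.adicCompletion K) | ∃ h : x ∈ (v.adicCompletionIntegers K), (⟨x, h⟩ : (v.adicCompletionIntegers K)) ∈ maximalIdeal (v.adicCompletionIntegers K)} = {x : (v.adicCompletion K) | Valued.v x < 1} := by
    ext x
    simp only [Set.mem_setOf_eq]
    constructor
    · rintro ⟨hx, hm⟩
      rw [IsLocalRing.mem_maximalIdeal, mem_nonunits_iff,
        HeightOneSpectrum.adicCompletionIntegers.isUnit_iff_valued_eq_one] at hm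
      exact lt_of_le_of_ne hx hm
    · intro hx
      refine ⟨le_of_lt hx, ?_⟩
      rw [IsLocalRing.mem_maximalIdeal, mem_nonunits_iff,
        HeightOneSpectrum.adicCompletionIntegers.isUnit_iff_valued_eq_one]
      exact hx.ne
  have hmopen : IsOpen {x : (v.adicCompletion K) | ∃ h : x ∈ (v.adicCompletionIntegers K), (⟨x, h⟩ : (v.adicCompletionIntegers K)) ∈ maximalIdeal (v.adicCompletionIntegers K)} := by
    rw [hmax]
    simpa only [Valuation.restrict_lt_one_iff] using Valued.isOpen_ball (v.adicCompletion K) 1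
  set φbar : absoluteGaloisGroup ℚ →* GL (Fin 2) (ResidueField (v.adicCompletionIntegers K)) :=
    (Matrix.GeneralLinearGroup.map (residue (v.adicCompletionIntegers K))).comp ρ₀ with hφbar
  have hφker : IsOpen (φbar.ker : Set (absoluteGaloisGroup ℚ)) :=
    GaloisRepresentations.isOpen_ker_residualRep hmopen hρ₀
  -- semisimplification over `(ResidueField (v.adicCompletionIntegers K))`
  obtain ⟨φss, hφss, hφsschar, hφssker⟩ :=
    Literature.RepresentationTheory.Semisimple.exists_semisimplification_fin_two φbar
  -- ### bookkeeping: the exponent, `ℓ ∈ v`, good primes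
  obtain ⟨m, hm⟩ : ∃ m : ℕ, k' - 1 = m := ⟨(k' - 1).toNat, (Int.toNat_of_nonneg (by omega)).symm⟩
  have hℓm : (ℓ - 1) ∣ m := by
    have h1 : ((ℓ : ℤ) - 1) ∣ (m : ℤ) := hm ▸ hℓk'
    have h2 : ((ℓ - 1 : ℕ) : ℤ) = (ℓ : ℤ) - 1 := by rw [Nat.cast_sub hℓ.one_le, Nat.cast_one]
    rw [← h2] at h1
    exact Int.natCast_dvd_natCast.mp h1
  have hιsurj : Function.Surjective ι := ZMod.ringHom_surjective ι
  have hℓv : ((ℓ : ℕ) : 𝓞 K) ∈ v.asIdeal := by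
    have h1 := hker (ℓ : coeffCharIntegers f) (by rw [map_natCast, ZMod.natCast_self])
    rw [show (((ℓ : coeffCharIntegers f) : coeffCharField f)) = (ℓ : coeffCharField f) by simp,
      map_natCast] at h1
    rw [← v.valuation_lt_one_iff_mem (K := K)]
    simpa using h1
  have hpv : ∀ p : ℕ, p.Prime → ¬ p ∣ N * ℓ → ((p : ℕ) : 𝓞 K) ∉ v.asIdeal := by
    intro p hp hpNℓ hpv
    have hpℓ : p ≠ ℓ := fun h ↦ hpNℓ (by rw [h]; exact dvd_mul_left ℓ N)
    have hcop : Nat.Coprime p ℓ := (Nat.coprime_primes hp hℓ).mpr hpℓ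
    have h1 : (1 : 𝓞 K) ∈ v.asIdeal := by
      have h := Nat.gcd_eq_gcd_ab p ℓ
      rw [hcop.gcd_eq_one, Nat.cast_one] at h
      have h' : (1 : 𝓞 K) = (p : 𝓞 K) * (Nat.gcdA p ℓ : 𝓞 K) + (ℓ : 𝓞 K) * (Nat.gcdB p ℓ : 𝓞 K) := by
        have := congrArg (fun z : ℤ ↦ (z : 𝓞 K)) h
        push_cast at this
        exact this
      rw [h']
      exact Ideal.add_mem _ (Ideal.mul_mem_right _ _ hpv) (Ideal.mul_mem_right _ _ hℓv)
    exact v.isPrime.ne_top ((Ideal.eq_top_iff_one _).mpr h1)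
  -- ### elements of `(v.adicCompletionIntegers K) = O_v` coming from `K`, and their residues
  have hval : ∀ x : K, Valued.v (algebraMap K (v.adicCompletion K) x) = v.valuation K x := fun x ↦
    HeightOneSpectrum.valuedAdicCompletion_eq_valuation' v x
  let toO : ∀ x : K, v.valuation K x ≤ 1 → (v.adicCompletionIntegers K) := fun x hx ↦
    ⟨algebraMap K (v.adicCompletion K) x, by rw [HeightOneSpectrum.mem_adicCompletionIntegers, hval]; exact hx⟩
  have htoO_coe : ∀ x hx, ((toO x hx : (v.adicCompletionIntegers K)) : (v.adicCompletion K)) = algebraMap K (v.adicCompletion K) x := fun _ _ ↦ rfl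
  have htoO_res : ∀ x hx, v.valuation K x < 1 → residue (v.adicCompletionIntegers K) (toO x hx) = 0 := by
    intro x hx hlt
    rw [residue_eq_zero_iff, IsLocalRing.mem_maximalIdeal, mem_nonunits_iff,
      HeightOneSpectrum.adicCompletionIntegers.isUnit_iff_valued_eq_one]
    change ¬ Valued.v (algebraMap K (v.adicCompletion K) x) = 1
    rw [hval]; exact hlt.ne
  have htoO_alg : ∀ r : 𝓞 K, toO (r : K) (v.valuation_le_one (K := K) r) = algebraMap (𝓞 K) (v.adicCompletionIntegers K) r :=
    fun r ↦ Subtype.ext rfl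
  have htoO_sub : ∀ x y hx hy hxy, toO x hx - toO y hy = toO (x - y) hxy :=
    fun x y hx hy hxy ↦ Subtype.ext (by
      change algebraMap K (v.adicCompletion K) x - algebraMap K (v.adicCompletion K) y = algebraMap K (v.adicCompletion K) (x - y); rw [map_sub])
  have htoO_mul : ∀ x y hx hy hxy, toO x hx * toO y hy = toO (x * y) hxy :=
    fun x y hx hy hxy ↦ Subtype.ext (by
      change algebraMap K (v.adicCompletion K) x * algebraMap K (v.adicCompletion K) y = algebraMap K (v.adicCompletion K) (x * y); rw [map_mul])
  have htoO_pow : ∀ x hx n hxn, toO x hx ^ n = toO (x ^ n) hxn :=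
    fun x hx n hxn ↦ Subtype.ext (by
      change algebraMap K (v.adicCompletion K) x ^ n = algebraMap K (v.adicCompletion K) (x ^ n); rw [map_pow])
  have htoO_nat : ∀ (n : ℕ) hn, toO (n : K) hn = (n : (v.adicCompletionIntegers K)) := fun n hn ↦ Subtype.ext (by
    change algebraMap K (v.adicCompletion K) n = ((n : (v.adicCompletionIntegers K)) : (v.adicCompletion K)); rw [map_natCast]; norm_cast)
  -- the map `𝓞_f → (ResidueField (v.adicCompletionIntegers K))(v)` through `i`, which factors through `ι`
  let cmap : coeffCharIntegers f →+* 𝓞 K := coeffCharIntegersMap f i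
  have hcmap : ∀ y : coeffCharIntegers f, ((cmap y : 𝓞 K) : K) = i y.1 := fun _ ↦ rfl
  let ψK : coeffCharIntegers f →+* (ResidueField (v.adicCompletionIntegers K)) := (residue (v.adicCompletionIntegers K)).comp ((algebraMap (𝓞 K) (v.adicCompletionIntegers K)).comp cmap)
  have hψK : ∀ y, ψK y = residue (v.adicCompletionIntegers K) (algebraMap (𝓞 K) (v.adicCompletionIntegers K) (cmap y)) := fun _ ↦ rfl
  have hkerle : RingHom.ker ι ≤ RingHom.ker ψK := by
    intro y hy
    rw [RingHom.mem_ker] at hy ⊢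
    rw [hψK, HeightOneSpectrum.residue_algebraMap_eq_zero_iff K v,
      ← v.valuation_lt_one_iff_mem (K := K)]
    exact hker y hy
  let j : ZMod ℓ →+* (ResidueField (v.adicCompletionIntegers K)) :=
    (ι.liftOfRightInverse (Function.surjInv hιsurj) (Function.rightInverse_surjInv hιsurj))
      ⟨ψK, hkerle⟩
  have hj : ∀ y : coeffCharIntegers f, j (ι y) = ψK y := fun y ↦
    RingHom.liftOfRightInverse_comp_apply ι _ _ ⟨ψK, hkerle⟩ y
  -- ### the integral Hecke polynomial and its reductions
  have hint : ∀ n, IsIntegral ℤ (cuspCoeff f n) := fun n ↦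
    IsNewform1.isIntegral_cuspCoeff hL le_rfl hf n
  let aInt : ℕ → coeffCharIntegers f := fun p ↦
    ⟨⟨cuspCoeff f p, cuspCoeff_mem_coeffCharField f p⟩, (isIntegral_coeffCharField_iff f).mpr (hint p)⟩
  let cInt : ℕ → coeffCharIntegers f := fun p ↦
    ⟨⟨(ε (p : ZMod N) : ℂ) * (p : ℂ) ^ ((1 : ℤ) - 1), nebentypus_mul_zpow_mem_coeffCharField f p⟩,
      (isIntegral_coeffCharField_iff f).mpr (isIntegral_nebentypus_mul_zpow f le_rfl p)⟩
  let εInt : ℕ → coeffCharIntegers f := fun p ↦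
    ⟨⟨(ε (p : ZMod N) : ℂ), nebentypus_mem_coeffCharField f p⟩,
      (isIntegral_coeffCharField_iff f).mpr (isIntegral_dirichletCharacter_apply ε _)⟩
  have hcε : ∀ p, cInt p = εInt p := fun p ↦ Subtype.ext (Subtype.ext (by
    change (ε (p : ZMod N) : ℂ) * (p : ℂ) ^ ((1 : ℤ) - 1) = ε (p : ZMod N)
    rw [sub_self, zpow_zero, mul_one]))
  let Pint : ℕ → Polynomial (coeffCharIntegers f) := fun p ↦ X ^ 2 - C (aInt p) * X + C (cInt p)
  have hPint : ∀ p : ℕ, (Pint p).map (algebraMap (coeffCharIntegers f) (coeffCharField f)) =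
      heckePolynomial f p := by
    intro p
    simp only [Pint, heckePolynomial, Polynomial.map_add, Polynomial.map_sub,
      Polynomial.map_mul, Polynomial.map_pow, Polynomial.map_X, Polynomial.map_C]
    rfl
  -- ### Frobenius characteristic polynomials of `φbar` at the good primes
  have hfrobchar : ∀ (w : HeightOneSpectrum (𝓞 ℚ)),
      ((primesEquiv w : Nat.Primes) : ℕ) ∉ {p : ℕ | p ∣ N * ℓ} →
      ∀ 𝔓 ∈ w.primesAbove, ∀ σ : absoluteGaloisGroup ℚ, IsArithFrobAt (𝓞 ℚ) σ 𝔓 →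
        ((φbar σ : GL (Fin 2) (ResidueField (v.adicCompletionIntegers K))) : Matrix (Fin 2) (Fin 2) (ResidueField (v.adicCompletionIntegers K))).charpoly =
          ((Pint ((primesEquiv w : Nat.Primes) : ℕ)).map ι).map j := by
    intro w hw 𝔓 h𝔓 σ hσ
    set p : ℕ := ((primesEquiv w : Nat.Primes) : ℕ) with hpdef
    have hp : p.Prime := (primesEquiv w).2
    have hpNℓ : ¬ p ∣ N * ℓ := hw
    have hpℓ : p ≠ ℓ := fun h ↦ hpNℓ (by rw [h]; exact dvd_mul_left ℓ N)
    have hpN : ¬ p ∣ N := fun h ↦ hpNℓ (h.mul_right ℓ)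
    obtain ⟨-, hchar⟩ := hρ w hpNℓ (hpv p hp hpNℓ)
    have hcσ := hchar 𝔓 h𝔓 σ hσ
    -- valuations of the coefficients
    have hcKp : c p = i (εInt p).1 := hc p hp hpNℓ
    have hvb : v.valuation K (b p) ≤ 1 := hbint p
    have hvc : v.valuation K (c p) ≤ 1 := by
      rw [hcKp, ← hcmap]; exact v.valuation_le_one (K := K) _
    have hvp : v.valuation K (p : K) ≤ 1 := by
      have := v.valuation_le_one (K := K) (p : 𝓞 K)
      simpa using this
    have hvpm : v.valuation K ((p : K) ^ m) ≤ 1 := by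
      rw [map_pow]; exact pow_le_one' hvp m
    have hvcp : v.valuation K (c p * (p : K) ^ m) ≤ 1 := by
      rw [map_mul]; exact mul_le_one' hvc hvpm
    -- the integral polynomial `Q₀ ∈ (v.adicCompletionIntegers K)[X]` and `charpoly (ρ₀ σ) = Q₀`
    let Q₀ : Polynomial (v.adicCompletionIntegers K) := X ^ 2 - C (toO (b p) hvb) * X + C (toO _ hvcp)
    have hQ₀ : Q₀.map (v.adicCompletionIntegers K).subtype =
        ((X ^ 2 - C (b p) * X + C (c p * (p : K) ^ (k' - 1))).map
          (algebraMap K (v.adicCompletion K))) := by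
      rw [hm, zpow_natCast]
      simp only [Q₀, Polynomial.map_add, Polynomial.map_sub, Polynomial.map_mul,
        Polynomial.map_pow, Polynomial.map_X, Polynomial.map_C]
      rfl
    have h0 : ((ρ₀ σ : GL (Fin 2) (v.adicCompletionIntegers K)) : Matrix (Fin 2) (Fin 2) (v.adicCompletionIntegers K)).charpoly = Q₀ := by
      apply Polynomial.map_injective (v.adicCompletionIntegers K).subtype Subtype.val_injective
      rw [GaloisRepresentations.charpoly_integralModel hρ₀ σ, hQ₀]
      exact hcσ
    -- residues of the coefficients
    have hres_b : residue (v.adicCompletionIntegers K) (toO (b p) hvb) = j (ι (aInt p)) := by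
      have hva : v.valuation K (i (aInt p).1) ≤ 1 := by rw [← hcmap]; exact v.valuation_le_one (K := K) _
      have h1 : residue (v.adicCompletionIntegers K) (toO (b p) hvb) - residue (v.adicCompletionIntegers K) (toO (i (aInt p).1) hva) = 0 := by
        rw [← map_sub, htoO_sub (b p) (i (aInt p).1) hvb hva ((hbcongr p hp hpNℓ).le)]
        exact htoO_res (b p - i (aInt p).1) ((hbcongr p hp hpNℓ).le) (hbcongr p hp hpNℓ)
      rw [sub_eq_zero] at h1
      rw [h1, hj, hψK, ← htoO_alg]
      rfl
    have hres_c : residue (v.adicCompletionIntegers K) (toO _ hvcp) = j (ι (cInt p)) := by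
      haveI := Fact.mk hℓ
      have hp0 : (p : ZMod ℓ) ≠ 0 := by
        rw [Ne, ZMod.natCast_eq_zero_iff]
        exact fun h ↦ hpℓ ((Nat.prime_dvd_prime_iff_eq hℓ hp).mp h).symm
      have hpm1 : (p : ZMod ℓ) ^ m = 1 := by
        obtain ⟨c, rfl⟩ := hℓm
        rw [pow_mul, ZMod.pow_card_sub_one_eq_one hp0, one_pow]
      have hpκ : (residue (v.adicCompletionIntegers K) (p : (v.adicCompletionIntegers K))) ^ m = 1 := by
        rw [map_natCast, show (p : (ResidueField (v.adicCompletionIntegers K))) = j (p : ZMod ℓ) from (map_natCast j p).symm, ← map_pow,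
          hpm1, map_one]
      have e1 : toO _ hvcp = toO (c p) hvc * (toO (p : K) hvp) ^ m := by
        rw [htoO_pow _ hvp m hvpm, htoO_mul _ _ hvc hvpm hvcp]
      have e2 : toO (c p) hvc = algebraMap (𝓞 K) (v.adicCompletionIntegers K) (cmap (εInt p)) := by
        rw [← htoO_alg]
        apply Subtype.ext
        change ((c p : K) : (v.adicCompletion K)) = (((cmap (εInt p) : 𝓞 K) : K) : (v.adicCompletion K))
        rw [hcKp, hcmap]
      rw [e1, map_mul, map_pow, htoO_nat p hvp, hpκ, mul_one, e2, hcε, hj, hψK]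
    rw [GaloisRepresentations.charpoly_residualRep ρ₀ σ, h0]
    simp only [Q₀, Pint, Polynomial.map_add, Polynomial.map_sub, Polynomial.map_mul,
      Polynomial.map_pow, Polynomial.map_X, Polynomial.map_C, hres_b, hres_c]
  -- ### (6.12.1): all characteristic polynomials of `φss` come from `𝔽_ℓ`
  have hT : ({p : ℕ | p ∣ N * ℓ}).Finite :=
    (Set.finite_Iic (N * ℓ)).subset fun q hq ↦ Nat.le_of_dvd
      (Nat.pos_of_ne_zero (mul_ne_zero (NeZero.ne N) hℓ.ne_zero)) hq
  have hQ : ∀ x : absoluteGaloisGroup ℚ, ∃ Q : Polynomial (ZMod ℓ),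
      Q.map j = ((φss x : GL (Fin 2) (ResidueField (v.adicCompletionIntegers K))) : Matrix (Fin 2) (Fin 2) (ResidueField (v.adicCompletionIntegers K))).charpoly := by
    intro x
    obtain ⟨w, hw, 𝔓, h𝔓, σ, hσ, hσx⟩ := exists_isArithFrobAt_apply_eq hCheb φbar hφker _ hT x
    refine ⟨(Pint ((primesEquiv w : Nat.Primes) : ℕ)).map ι, ?_⟩
    rw [hφsschar x, ← hσx]
    exact (hfrobchar w hw 𝔓 h𝔓 σ hσ).symm
  -- ### Lemme 6.13 over `𝔽_ℓ ⊆ (ResidueField (v.adicCompletionIntegers K))(v)`, and a last semisimplification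
  obtain ⟨ρ₁, hρ₁ker, hρ₁char⟩ := hdesc (absoluteGaloisGroup ℚ) (ZMod ℓ)
    (ResidueField (v.adicCompletionIntegers K)) j φss hφss hQ
  obtain ⟨ρ₂, hρ₂ss, hρ₂char, hρ₂ker⟩ :=
    Literature.RepresentationTheory.Semisimple.exists_semisimplification_fin_two ρ₁
  have hsubinj : Function.Injective (Matrix.GeneralLinearGroup.map (n := Fin 2) (v.adicCompletionIntegers K).subtype) :=
    generalLinearGroup_map_injective_of_injective (v.adicCompletionIntegers K).subtype Subtype.val_injective
  -- kernels: `ρ σ = 1 → ρ₂ σ = 1`, `ker φbar ≤ ker ρ₂`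
  have hker₂ : φbar.ker ≤ ρ₂.ker := fun x hx ↦ hρ₂ker (hρ₁ker (hφssker hx))
  have hchain : ∀ σ, ρ σ = 1 → ρ₂ σ = 1 := by
    intro σ hσ
    have h1 : ρ₀ σ = 1 := hsubinj (by rw [hρ₀, hσ, mul_one, inv_mul_cancel, map_one])
    exact hker₂ (show φbar σ = 1 by rw [hφbar, MonoidHom.comp_apply, h1, map_one])
  -- ### the mod-`ℓ` representation
  let ρbar : GaloisRepresentations.FramedGaloisRep ℚ (ZMod ℓ) 2 :=
    ⟨ρ₂, continuous_of_isOpen_of_le_ker ρ₂ φbar.ker hφker hker₂⟩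
  have hρbar : ∀ σ, ρbar σ = ρ₂ σ := fun _ ↦ rfl
  refine ⟨ρbar, fun w hw ↦ ⟨?_, Pint _, hPint _, ?_⟩, ?_⟩
  · -- unramified
    intro 𝔓 h𝔓 σ hσ
    obtain ⟨hunr, -⟩ := hρ w hw (hpv _ (primesEquiv w).2 hw)
    rw [hρbar]
    exact hchain σ (hunr 𝔓 h𝔓 σ hσ)
  · -- Frobenius characteristic polynomials
    intro 𝔓 h𝔓 σ hσ
    change ((ρ₂ σ : GL (Fin 2) (ZMod ℓ)) : Matrix (Fin 2) (Fin 2) (ZMod ℓ)).charpoly = _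
    apply Polynomial.map_injective j j.injective
    rw [hρ₂char, hρ₁char, hφsschar σ, hfrobchar w hw 𝔓 h𝔓 σ hσ]
  · -- semisimple
    exact hρ₂ss

set_option maxHeartbeats 1600000 in
/-- **Deligne–Serre 1974, Thm. 6.7 (weight one, `k_λ = 𝔽_ℓ`) from Thm. 6.1 and a descent
statement.** As `thm67_weightOne_of_thm61` below, but with Lemme 6.13 replaced by the weaker
descent statement `hdesc` actually used (for a semisimple `φ : G → GL₂(K)`, `K` finite, with
characteristic polynomials in `k[X]`, `k` finite: some `ρ : G → GL₂(k)` with `ker φ ≤ ker ρ` and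
the same characteristic polynomials), which follows both from Lemme 6.13 as printed and from
`Literature.RepresentationTheory.Semisimple.exists_descent_fin_two` (proved in the tree).
[cite: DeligneSerreASENS1974, Thm. 6.7, 6.8–6.13 and §8.2] -/
theorem thm67_weightOne_of_descent
    (h61 : ∀ (M : ℕ) [NeZero M] (k : ℤ), 2 ≤ k →
      ∀ (g : CuspForm (Gamma1 M) k) (χ : DirichletCharacter ℂ M),
        g ∈ nebentypusSubspace M k χ → g ≠ 0 →
      ∀ (K : Type) [Field K] [NumberField K] (e : K →+* ℂ) (a : ℕ → K) (c : ZMod M → K),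
        (∀ d, e (c d) = χ d) →
        (∀ (p : ℕ) (hp : p.Prime), ¬ p ∣ M →
          (haveI : NeZero p := ⟨hp.ne_zero⟩; heckeT (Gamma1 M) k p g) = e (a p) • g) →
      ∀ v : HeightOneSpectrum (𝓞 K),
        ∃ ρ : GaloisRepresentations.FramedGaloisRep ℚ (v.adicCompletion K) 2,
          ρ.toGaloisRep.IsSemisimple ∧
          ∀ w : HeightOneSpectrum (𝓞 ℚ), ¬ ((primesEquiv w : Nat.Primes) : ℕ) ∣ M →
            (((primesEquiv w : Nat.Primes) : ℕ) : 𝓞 K) ∉ v.asIdeal →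
            ρ.IsUnramifiedAt w ∧
            ρ.HasFrobCharpolyAt w
              ((X ^ 2 - C (a ((primesEquiv w : Nat.Primes) : ℕ)) * X +
                C (c ((primesEquiv w : Nat.Primes) : ℕ) *
                  (((primesEquiv w : Nat.Primes) : ℕ) : K) ^ (k - 1))).map
                (algebraMap K (v.adicCompletion K))))
    (hdesc : ∀ (G : Type) [Group G] (k K : Type) [Field k] [Fintype k] [Field K] [Finite K]
      (j : k →+* K) (φ : G →* GL (Fin 2) K),
      Representation.IsSemisimpleRepresentation
        ((Representation.ofDistribMulAction K (GL (Fin 2) K) (Fin 2 → K)).comp φ) →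
      (∀ x, ∃ Q : Polynomial k,
        Q.map j = ((φ x : GL (Fin 2) K) : Matrix (Fin 2) (Fin 2) K).charpoly) →
      ∃ ρ : G →* GL (Fin 2) k, φ.ker ≤ ρ.ker ∧
        ∀ x, (((ρ x : GL (Fin 2) k) : Matrix (Fin 2) (Fin 2) k).charpoly).map j =
          ((φ x : GL (Fin 2) K) : Matrix (Fin 2) (Fin 2) K).charpoly)
    (hCheb : LFunctions.Chebotarev.dirichletDensity_eq.{0})
    (hL : DeligneSerre1974_span_integralLattice1 N 1) :
    thm67_weightOne (N := N) := by
  intro f hf ℓ _ ι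
  classical
  have hℓ : ℓ.Prime := Fact.out
  -- ### 6.8–6.11: the eigenform `g` of weight `k' ≥ 2` at level `N ℓ`
  obtain ⟨K, _, _, e, i, v, k', g, b, hei, hk', hℓk', hg0, hgW, hgT, hker, hbint, hbcongr⟩ :=
    exists_eigenform_congr_of_weight_one hL hf ℓ ι
  haveI : NeZero (N * ℓ) := ⟨mul_ne_zero (NeZero.ne N) hℓ.ne_zero⟩
  set ε : DirichletCharacter ℂ N := nebentypus f with hεdef
  set χ : DirichletCharacter ℂ (N * ℓ) := DirichletCharacter.changeLevel (dvd_mul_right N ℓ) ε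
    with hχdef
  -- the values of `χ` lie in `K_f`
  have hχmem : ∀ d : ZMod (N * ℓ), χ d ∈ coeffCharField f := by
    intro d
    by_cases hd : IsUnit d
    · obtain ⟨u, rfl⟩ := hd
      rw [hχdef, DirichletCharacter.changeLevel_eq_cast_of_dvd ε (dvd_mul_right N ℓ) u,
        ← ZMod.natCast_zmod_val (ZMod.cast (u : ZMod (N * ℓ)) : ZMod N)]
      exact nebentypus_mem_coeffCharField f _
    · rw [MulChar.map_nonunit χ hd]; exact zero_mem _
  let cK : ZMod (N * ℓ) → K := fun d ↦ i ⟨χ d, hχmem d⟩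
  have hcK : ∀ d, e (cK d) = χ d := fun d ↦ hei _
  -- ### Thm. 6.1 at level `N ℓ`, place `v`
  obtain ⟨ρ, -, hρ⟩ := h61 (N * ℓ) k' hk' g χ hgW hg0 K e b cK hcK hgT v
  -- ### 6.12–6.13
  refine thm67_weightOne_core hdesc hCheb hL hf ℓ ι i v hk' hℓk' b (fun p ↦ cK (p : ZMod (N * ℓ)))
    hker hbint hbcongr (fun p hp hpNℓ ↦ ?_) ρ hρ
  have hcop : IsCoprime (p : ℤ) ((N * ℓ : ℕ) : ℤ) :=
    Nat.isCoprime_iff_coprime.mpr ((Nat.Prime.coprime_iff_not_dvd hp).mpr hpNℓ)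
  have hχp : χ (p : ZMod (N * ℓ)) = ε (p : ZMod N) := by
    have := DirichletCharacter.changeLevel_eq_cast_of_dvd' ε (dvd_mul_right N ℓ) hcop
    simpa using this
  change i ⟨χ (p : ZMod (N * ℓ)), hχmem _⟩ = i _
  congr 1
  exact Subtype.ext hχp

set_option maxHeartbeats 1600000 in
/-- **Deligne–Serre 1974, Thm. 6.7 (weight one, `k_λ = 𝔽_ℓ`) from Thm. 6.1 and Lemme 6.13.**
Hypotheses: `h61` = Thm. 6.1 as printed (Deligne's `λ`-adic representations attached to an
eigenform of weight `≥ 2` of the `T_p`, `p ∤ M`, in `S_k(M, χ)`, for *every* finite place `v`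
of a number field `K ∋ a_p, χ(p)`: a continuous semisimple `ρ : Gal(ℚ̄/ℚ) → GL₂(K_v)`,
unramified at `p ∤ M` with `p ∉ v`, with `det(X - ρ(F_p)) = X² - a_p X + χ(p) p^{k-1}`);
`h613` = Lemme 6.13 for `n = 2` (a semisimple representation over a finite field `K` all of
whose characteristic polynomials come from the subfield `k` is conjugate to one defined over
`k`); `hCheb` = Chebotarev (Neukirch VII (13.4)); `hL` = (2.7.2) in weight one. Conclusion: the
named fact `thm67_weightOne`. Proof = op. cit. 6.8–6.13: `exists_eigenform_congr_of_weight_one`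
(6.8–6.11: an eigenform `g ∈ S_{k'}(N ℓ, ε)`, `k' ≥ 2`, `(ℓ-1) ∣ (k'-1)`, with eigenvalues
`b_p ≡ a_p (mod v)`), `h61` at level `N ℓ` and the place `v`, an integral model and its reduction
modulo `𝔪_v` (`exists_integralModel`, `isOpen_ker_residualRep`), the semisimplification
(`exists_semisimplification_fin_two`), the Frobenius coverage (`exists_isArithFrobAt_apply_eq`,
giving (6.12.1)), `h613` with `k = 𝔽_ℓ ⊆ κ(v)`, and a final semisimplification over `𝔽_ℓ`.
[cite: DeligneSerreASENS1974, Thm. 6.7, 6.8–6.13 and §8.2] -/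
theorem thm67_weightOne_of_thm61
    (h61 : ∀ (M : ℕ) [NeZero M] (k : ℤ), 2 ≤ k →
      ∀ (g : CuspForm (Gamma1 M) k) (χ : DirichletCharacter ℂ M),
        g ∈ nebentypusSubspace M k χ → g ≠ 0 →
      ∀ (K : Type) [Field K] [NumberField K] (e : K →+* ℂ) (a : ℕ → K) (c : ZMod M → K),
        (∀ d, e (c d) = χ d) →
        (∀ (p : ℕ) (hp : p.Prime), ¬ p ∣ M →
          (haveI : NeZero p := ⟨hp.ne_zero⟩; heckeT (Gamma1 M) k p g) = e (a p) • g) →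
      ∀ v : HeightOneSpectrum (𝓞 K),
        ∃ ρ : GaloisRepresentations.FramedGaloisRep ℚ (v.adicCompletion K) 2,
          ρ.toGaloisRep.IsSemisimple ∧
          ∀ w : HeightOneSpectrum (𝓞 ℚ), ¬ ((primesEquiv w : Nat.Primes) : ℕ) ∣ M →
            (((primesEquiv w : Nat.Primes) : ℕ) : 𝓞 K) ∉ v.asIdeal →
            ρ.IsUnramifiedAt w ∧
            ρ.HasFrobCharpolyAt w
              ((X ^ 2 - C (a ((primesEquiv w : Nat.Primes) : ℕ)) * X +
                C (c ((primesEquiv w : Nat.Primes) : ℕ) *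
                  (((primesEquiv w : Nat.Primes) : ℕ) : K) ^ (k - 1))).map
                (algebraMap K (v.adicCompletion K))))
    (h613 : ∀ (G : Type) [Group G] (k K : Type) [Field k] [Finite k] [Field K] [Finite K]
      (j : k →+* K) (φ : G →* GL (Fin 2) K),
      Representation.IsSemisimpleRepresentation
        ((Representation.ofDistribMulAction K (GL (Fin 2) K) (Fin 2 → K)).comp φ) →
      (∀ x, ∃ Q : Polynomial k,
        Q.map j = ((φ x : GL (Fin 2) K) : Matrix (Fin 2) (Fin 2) K).charpoly) →
      ∃ (ρ : G →* GL (Fin 2) k) (T : GL (Fin 2) K),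
        ∀ x, Matrix.GeneralLinearGroup.map j (ρ x) = T * φ x * T⁻¹)
    (hCheb : LFunctions.Chebotarev.dirichletDensity_eq.{0})
    (hL : DeligneSerre1974_span_integralLattice1 N 1) :
    thm67_weightOne (N := N) := by
  refine thm67_weightOne_of_descent h61 (fun G _ k K _ _ _ _ j φ hss hQ ↦ ?_) hCheb hL
  obtain ⟨ρ, T, hρ⟩ := h613 G k K j φ hss hQ
  have hjinj : Function.Injective (Matrix.GeneralLinearGroup.map (n := Fin 2) j) :=
    generalLinearGroup_map_injective_of_injective j j.injective
  refine ⟨ρ, fun x hx ↦ ?_, fun x ↦ ?_⟩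
  · rw [MonoidHom.mem_ker] at hx ⊢
    exact hjinj (by rw [hρ, hx, mul_one, mul_inv_cancel, map_one])
  · rw [← Matrix.charpoly_map]
    have h1 : ((ρ x : GL (Fin 2) k) : Matrix (Fin 2) (Fin 2) k).map j =
        ((Matrix.GeneralLinearGroup.map j (ρ x) : GL (Fin 2) K) : Matrix (Fin 2) (Fin 2) K) := rfl
    rw [h1, hρ, Units.val_mul, Units.val_mul, Matrix.coe_units_inv]
    exact Matrix.charpoly_units_conj T _

end Main

end Literature.NumberTheory.EllipticCurves.ModularForms.DeligneSerre1974
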